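import Mathlib
import HarnessLib
import Summits.Ventures.LatticeQCDFlow.Scaling.AcceptanceVolumeFloorRigidityBlocks
import Summits.Ventures.LatticeQCDFlow.Scoring.PairAcceptanceVarianceRigidity

/-!
# LatticeQCDFlow / Scaling — RIGIDITY of the acceptance CEILINGS of a factorised flow:
# `acc(p₁⊗p₂, q₁⊗q₂) = acc(p₁,q₁)` iff the other block is PERFECT, and
# `acc = BC²` (so `acc(⊗) = ∏ᵢ BCᵢ²`) iff (every block of) the flow is HIT-OR-MISS

HONEST FRAMING: exact (Metropolis-corrected) sampling algorithms for lattice gauge theory;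
figures of merit are autocorrelation/cost numbers at stated couplings and volumes; no
continuum-physics claim.

Venture `LatticeQCDFlow` (cell pub-lqcd), topic `Scaling`; FANOUT row 3 (`s0-u1-a`, S0-B
implementation A, GEN-13).  NEW WORK of the cell (elementary finite sums); NO definition is
introduced.  Companion of row 3's `Scaling/AcceptanceVolumeFloorRigidity(Blocks)` (imported: the
equality case of the FLOOR `∏ accᵢ ≤ acc(⊗)`, the hit-or-miss calculus of products) for the two
CEILINGS of row 3's `Scaling/AcceptanceVolumeSandwich` (`acc(⊗) ≤ accᵢ`) and row 31's
`Scaling/Bhattacharyya` (`acc ≤ BC²`, `BC(⊗) = ∏ BCᵢ`, T2-M/T2-M′).  Vocabulary: `accRate`, `prodLaw`,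
`blockProd`, `weight`, `bhatt`; `min_sq_le_mul` / `min_sq_eq_mul_iff` of row 3's
`Scoring/PairAcceptanceVarianceRigidity` (imported).  Hit-or-miss: `∀ x x′, 0 < p x → 0 < p x′ → w x = w x′`.

* §1 **`accRate_eq_one_iff`** — for normalised `p, q`: `acc(p, q) = 1 ↔ p = q`
  (the only flow accepted surely is the perfect one);
* §2 the defect `acc₁ − acc(p₁⊗p₂, q₁⊗q₂)` as a double sum of nonnegative brackets
  (`accRate_sub_accRate_prodLaw_eq`, `sum_sum_min_mul_le_min`) and
  **`accRate_prodLaw_eq_left_iff`** / **`accRate_prodLaw_eq_right_iff`** — `acc(⊗) = acc₁ ↔ p₂ = q₂`,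
  `acc(⊗) = acc₂ ↔ p₁ = q₁`: gluing a block costs acceptance unless it is sampled perfectly
  (the diagonal bracket `x = x′` reads `p₁x q₁x · (1 − acc₂)`);
* §3 **`accRate_eq_bhatt_sq_iff`** — for `p ≥ 0`, `q > 0`: `acc(p, q) = BC(p, q)² ↔ (p, q)` is
  hit-or-miss (termwise `min(a, a′) = √(a a′)` iff `a = a′` or a zero); hence for `m` normalised blocks
  **`accRate_blockProd_eq_prod_bhatt_sq_iff`** — `acc(⊗pᵢ, ⊗qᵢ) = ∏ᵢ BC(pᵢ, qᵢ)² ↔` EVERY block is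
  hit-or-miss.

Reading (value-free): together with the floor rigidity, the three volume laws
`∏ accᵢ ≤ acc(⊗) ≤ min(minᵢ accᵢ, ∏ BCᵢ²)` are each attained only degenerately — the product floor
when all blocks but one are all-or-nothing, the worst-block ceiling when all other blocks are perfect,
the Bhattacharyya ceiling when all blocks are all-or-nothing; a factorised flow with graded weights in
two or more blocks sits strictly inside the sandwich.  NOT CLAIMED: quantitative gaps; the
general-space form; coupled flows; any number of ours.
-/

namespace Summit.Ventures.LatticeQCDFlow.Theory2

open Finset
open Summit.Ventures.LatticeQCDFlow.Exactness
open Summit.Ventures.LatticeQCDFlow.Scoring (min_sq_le_mul min_sq_eq_mul_iff)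

/-! ## §1 The only surely-accepted flow is the perfect one -/

section Perfect

variable {X : Type*} [Fintype X]

/-- The defect `1 − acc(p, q) = Σ_{x,y} (p x q y − min(p x q y, p y q x))` for normalised `p, q`.
[ours] -/
theorem one_sub_accRate_eq {p q : X → ℝ} (hp1 : ∑ x, p x = 1) (hq1 : ∑ x, q x = 1) :
    1 - accRate p q = ∑ x, ∑ y, (p x * q y - min (p x * q y) (p y * q x)) := by
  unfold accRate
  simp only [sum_sub_distrib]
  rw [← sum_mul_sum, hp1, hq1, mul_one]

/-- **`acc(p, q) = 1 ↔ p = q`** for normalised target and model (no sign needed): equality in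
`min(p x q y, p y q x) ≤ p x q y` for all pairs forces `p x q y = p y q x`, and summing over `y`
gives `p = q`. [ours] -/
theorem accRate_eq_one_iff {p q : X → ℝ} (hp1 : ∑ x, p x = 1) (hq1 : ∑ x, q x = 1) :
    accRate p q = 1 ↔ p = q := by
  constructor
  · intro h
    have h0 : ∑ x, ∑ y, (p x * q y - min (p x * q y) (p y * q x)) = 0 := by
      rw [← one_sub_accRate_eq hp1 hq1, h, sub_self]
    have hnn : ∀ x y, 0 ≤ p x * q y - min (p x * q y) (p y * q x) :=
      fun x y => sub_nonneg.2 (min_le_left _ _)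
    rw [sum_eq_zero_iff_of_nonneg fun x _ => sum_nonneg fun y _ => hnn x y] at h0
    have hle : ∀ x y, p x * q y ≤ p y * q x := by
      intro x y
      have hx := h0 x (mem_univ x)
      rw [sum_eq_zero_iff_of_nonneg fun y _ => hnn x y] at hx
      have hxy := hx y (mem_univ y)
      rw [sub_eq_zero] at hxy
      rw [hxy]
      exact min_le_right _ _
    funext x
    calc p x = ∑ y, p x * q y := by rw [← mul_sum, hq1, mul_one]
      _ = ∑ y, p y * q x := sum_congr rfl fun y _ => le_antisymm (hle x y) (hle y x)
      _ = q x := by rw [← sum_mul, hp1, one_mul]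
  · rintro rfl
    unfold accRate
    rw [← hp1, ← mul_one (∑ x, p x), ← hp1, sum_mul_sum]
    exact sum_congr rfl fun x _ => sum_congr rfl fun y _ => by rw [mul_comm (p y), min_self]

end Perfect

/-! ## §2 The worst-block ceiling is attained only when the other block is perfect -/

section TwoBlocks

variable {X Y : Type*} [Fintype X] [Fintype Y]

/-- `Σ_{y,y′} min(a·B, a′·B′) ≤ min(a, a′)` when `Σ_{y,y′} B = Σ_{y,y′} B′ = 1`
(`B = p₂y q₂y′`, `B′ = p₂y′ q₂y`; normalisation only). [ours] -/
theorem sum_sum_min_mul_le_min {p₂ q₂ : Y → ℝ}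
    (hp₂1 : ∑ y, p₂ y = 1) (hq₂1 : ∑ y, q₂ y = 1) (a a' : ℝ) :
    ∑ y, ∑ y', min (a * (p₂ y * q₂ y')) (a' * (p₂ y' * q₂ y)) ≤ min a a' := by
  have hB : ∑ y, ∑ y', p₂ y * q₂ y' = 1 := by rw [← sum_mul_sum, hp₂1, hq₂1, mul_one]
  have hB' : ∑ y, ∑ y', p₂ y' * q₂ y = 1 := by rw [sum_comm, ← sum_mul_sum, hp₂1, hq₂1, mul_one]
  refine le_min ?_ ?_
  · calc ∑ y, ∑ y', min (a * (p₂ y * q₂ y')) (a' * (p₂ y' * q₂ y))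
        ≤ ∑ y, ∑ y', a * (p₂ y * q₂ y') := sum_le_sum fun y _ => sum_le_sum fun y' _ => min_le_left _ _
      _ = a * ∑ y, ∑ y', p₂ y * q₂ y' := by simp_rw [mul_sum]
      _ = a := by rw [hB, mul_one]
  · calc ∑ y, ∑ y', min (a * (p₂ y * q₂ y')) (a' * (p₂ y' * q₂ y))
        ≤ ∑ y, ∑ y', a' * (p₂ y' * q₂ y) := sum_le_sum fun y _ => sum_le_sum fun y' _ => min_le_right _ _
      _ = a' * ∑ y, ∑ y', p₂ y' * q₂ y := by simp_rw [mul_sum]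
      _ = a' := by rw [hB', mul_one]

/-- **The defect of the worst-block ceiling**:
`acc(p₁,q₁) − acc(p₁⊗p₂, q₁⊗q₂) = Σ_{x,x′} (min(a,a′) − Σ_{y,y′} min(a·B, a′·B′))` with
`a = p₁x q₁x′`, `a′ = p₁x′ q₁x`. [ours] -/
theorem accRate_sub_accRate_prodLaw_eq (p₁ q₁ : X → ℝ) (p₂ q₂ : Y → ℝ) :
    accRate p₁ q₁ - accRate (prodLaw p₁ p₂) (prodLaw q₁ q₂)
      = ∑ x, ∑ x', (min (p₁ x * q₁ x') (p₁ x' * q₁ x)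
          - ∑ y, ∑ y', min (p₁ x * q₁ x' * (p₂ y * q₂ y')) (p₁ x' * q₁ x * (p₂ y' * q₂ y))) := by
  rw [accRate_prodLaw_eq]
  unfold accRate
  simp only [sum_sub_distrib]

omit [Fintype X] in
/-- On the DIAGONAL `x = x′` the bracket is `p₁x q₁x · (1 − acc(p₂, q₂))`. [ours] -/
theorem diag_bracket_eq {p₁ q₁ : X → ℝ} (hp₁ : ∀ x, 0 ≤ p₁ x) (hq₁ : ∀ x, 0 ≤ q₁ x)
    (p₂ q₂ : Y → ℝ) (x : X) :
    min (p₁ x * q₁ x) (p₁ x * q₁ x)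
        - ∑ y, ∑ y', min (p₁ x * q₁ x * (p₂ y * q₂ y')) (p₁ x * q₁ x * (p₂ y' * q₂ y))
      = p₁ x * q₁ x * (1 - accRate p₂ q₂) := by
  rw [min_self]
  unfold accRate
  simp_rw [← mul_min_of_nonneg _ _ (mul_nonneg (hp₁ x) (hq₁ x)), ← mul_sum]
  ring

/-- **RIGIDITY OF THE WORST-BLOCK CEILING (left)**: for a normalised nonnegative first block with
positive model and a normalised nonnegative second block,
`acc(p₁⊗p₂, q₁⊗q₂) = acc(p₁, q₁) ↔ p₂ = q₂` — gluing an independent block costs acceptance unless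
that block is sampled perfectly. [ours] -/
theorem accRate_prodLaw_eq_left_iff {p₁ q₁ : X → ℝ} {p₂ q₂ : Y → ℝ} (hp₁ : ∀ x, 0 ≤ p₁ x)
    (hq₁ : ∀ x, 0 < q₁ x) (hp₁1 : ∑ x, p₁ x = 1) (hp₂ : ∀ y, 0 ≤ p₂ y) (hq₂ : ∀ y, 0 ≤ q₂ y)
    (hp₂1 : ∑ y, p₂ y = 1) (hq₂1 : ∑ y, q₂ y = 1) :
    accRate (prodLaw p₁ p₂) (prodLaw q₁ q₂) = accRate p₁ q₁ ↔ p₂ = q₂ := by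
  classical
  have hnn : ∀ x x', 0 ≤ min (p₁ x * q₁ x') (p₁ x' * q₁ x)
      - ∑ y, ∑ y', min (p₁ x * q₁ x' * (p₂ y * q₂ y')) (p₁ x' * q₁ x * (p₂ y' * q₂ y)) :=
    fun x x' => sub_nonneg.2 (sum_sum_min_mul_le_min hp₂1 hq₂1 _ _)
  constructor
  · intro h
    have h0 : ∑ x, ∑ x', (min (p₁ x * q₁ x') (p₁ x' * q₁ x)
        - ∑ y, ∑ y', min (p₁ x * q₁ x' * (p₂ y * q₂ y')) (p₁ x' * q₁ x * (p₂ y' * q₂ y))) = 0 := by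
      rw [← accRate_sub_accRate_prodLaw_eq, h, sub_self]
    obtain ⟨x₀, -, hx₀⟩ := exists_lt_of_sum_lt (s := univ) (f := fun _ => (0 : ℝ)) (g := p₁)
      (by rw [sum_const_zero, hp₁1]; exact one_pos)
    rw [sum_eq_zero_iff_of_nonneg fun x _ => sum_nonneg fun x' _ => hnn x x'] at h0
    have h1 := h0 x₀ (mem_univ x₀)
    rw [sum_eq_zero_iff_of_nonneg fun x' _ => hnn x₀ x'] at h1
    have h2 := h1 x₀ (mem_univ x₀)
    rw [diag_bracket_eq hp₁ (fun x => (hq₁ x).le), mul_eq_zero, sub_eq_zero] at h2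
    rcases h2 with h2 | h2
    · exact absurd h2 (mul_pos hx₀ (hq₁ x₀)).ne'
    · exact (accRate_eq_one_iff hp₂1 hq₂1).1 h2.symm
  · rintro rfl
    rw [← sub_eq_zero, ← neg_sub, neg_eq_zero, accRate_sub_accRate_prodLaw_eq]
    refine sum_eq_zero fun x _ => sum_eq_zero fun x' _ => ?_
    rw [sub_eq_zero]
    have hB : ∑ y, ∑ y', p₂ y * p₂ y' = 1 := by rw [← sum_mul_sum, hp₂1, mul_one]
    calc min (p₁ x * q₁ x') (p₁ x' * q₁ x)
        = min (p₁ x * q₁ x') (p₁ x' * q₁ x) * ∑ y, ∑ y', p₂ y * p₂ y' := by rw [hB, mul_one]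
      _ = ∑ y, ∑ y', min (p₁ x * q₁ x') (p₁ x' * q₁ x) * (p₂ y * p₂ y') := by simp_rw [mul_sum]
      _ = _ := sum_congr rfl fun y _ => sum_congr rfl fun y' _ => by
          rw [min_mul_of_nonneg _ _ (mul_nonneg (hp₂ y) (hp₂ y')), mul_comm (p₂ y') (p₂ y)]

/-- **RIGIDITY OF THE WORST-BLOCK CEILING (right)**: `acc(p₁⊗p₂, q₁⊗q₂) = acc(p₂, q₂) ↔ p₁ = q₁`.
[ours] -/
theorem accRate_prodLaw_eq_right_iff {p₁ q₁ : X → ℝ} {p₂ q₂ : Y → ℝ} (hp₁ : ∀ x, 0 ≤ p₁ x)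
    (hq₁ : ∀ x, 0 ≤ q₁ x) (hp₁1 : ∑ x, p₁ x = 1) (hq₁1 : ∑ x, q₁ x = 1) (hp₂ : ∀ y, 0 ≤ p₂ y)
    (hq₂ : ∀ y, 0 < q₂ y) (hp₂1 : ∑ y, p₂ y = 1) :
    accRate (prodLaw p₁ p₂) (prodLaw q₁ q₂) = accRate p₂ q₂ ↔ p₁ = q₁ := by
  rw [accRate_prodLaw_swap]
  exact accRate_prodLaw_eq_left_iff hp₂ hq₂ hp₂1 hp₁ hq₁ hp₁1 hq₁1

end TwoBlocks

/-! ## §3 The Bhattacharyya ceiling is attained only by hit-or-miss flows -/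

section Bhattacharyya

variable {X : Type*} [Fintype X]

omit [Fintype X] in
/-- For `a, a′ ≥ 0`: `min(a, a′) ≤ √(a a′)`, with equality iff `a = a′ ∨ a = 0 ∨ a′ = 0`. [folklore] -/
theorem min_eq_sqrt_mul_iff {a a' : ℝ} (ha : 0 ≤ a) (ha' : 0 ≤ a') :
    min a a' = Real.sqrt (a * a') ↔ a = a' ∨ a = 0 ∨ a' = 0 := by
  rw [← min_sq_eq_mul_iff ha ha']
  constructor
  · intro h
    rw [h, Real.sq_sqrt (mul_nonneg ha ha')]
  · intro h
    rw [← h, Real.sqrt_sq (le_min ha ha')]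

/-- **The Bhattacharyya defect**: `BC(p,q)² − acc(p,q) = Σ_{x,y} (√(a a′) − min(a, a′))`,
`a = p x q y`, `a′ = p y q x` (note `√(p x q x)√(p y q y) = √(a a′)`). [ours] -/
theorem bhatt_sq_sub_accRate_eq {p q : X → ℝ} (hp : ∀ x, 0 ≤ p x) (hq : ∀ x, 0 ≤ q x) :
    bhatt p q ^ 2 - accRate p q
      = ∑ x, ∑ y, (Real.sqrt (p x * q y * (p y * q x)) - min (p x * q y) (p y * q x)) := by
  unfold bhatt accRate
  rw [sq, sum_mul_sum]
  simp only [sum_sub_distrib]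
  congr 1
  refine sum_congr rfl fun x _ => sum_congr rfl fun y _ => ?_
  rw [← Real.sqrt_mul (mul_nonneg (hp x) (hq x))]
  ring_nf

/-- **RIGIDITY OF THE BHATTACHARYYA CEILING**: for a nonnegative target and a positive model,
`acc(p, q) = BC(p, q)²` iff the pair is hit-or-miss (all positive weights equal). [ours] -/
theorem accRate_eq_bhatt_sq_iff {p q : X → ℝ} (hp : ∀ x, 0 ≤ p x) (hq : ∀ x, 0 < q x) :
    accRate p q = bhatt p q ^ 2 ↔ ∀ x y, 0 < p x → 0 < p y → weight p q x = weight p q y := by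
  have hq' : ∀ x, 0 ≤ q x := fun x => (hq x).le
  have hnn : ∀ x y, 0 ≤ Real.sqrt (p x * q y * (p y * q x)) - min (p x * q y) (p y * q x) :=
    fun x y => sub_nonneg.2 (Real.le_sqrt_of_sq_le
      (min_sq_le_mul (mul_nonneg (hp x) (hq' y)) (mul_nonneg (hp y) (hq' x))))
  rw [eq_comm, ← sub_eq_zero, bhatt_sq_sub_accRate_eq hp hq',
    sum_eq_zero_iff_of_nonneg fun x _ => sum_nonneg fun y _ => hnn x y]
  simp only [mem_univ, true_implies]
  constructor
  · intro h x y hx hy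
    have hxy := h x
    rw [sum_eq_zero_iff_of_nonneg fun y _ => hnn x y] at hxy
    have e := hxy y (mem_univ y)
    rw [sub_eq_zero, eq_comm, min_eq_sqrt_mul_iff (mul_nonneg (hp x) (hq' y))
      (mul_nonneg (hp y) (hq' x))] at e
    rcases e with e | e | e
    · unfold weight
      rw [div_eq_div_iff (hq x).ne' (hq y).ne']
      linarith
    · exact absurd e (mul_pos hx (hq y)).ne'
    · exact absurd e (mul_pos hy (hq x)).ne'
  · intro h x
    refine sum_eq_zero fun y _ => ?_
    rw [sub_eq_zero, eq_comm, min_eq_sqrt_mul_iff (mul_nonneg (hp x) (hq' y))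
      (mul_nonneg (hp y) (hq' x))]
    by_cases hx : p x = 0
    · exact Or.inr (Or.inl (by rw [hx, zero_mul]))
    by_cases hy : p y = 0
    · exact Or.inr (Or.inr (by rw [hy, zero_mul]))
    exact Or.inl (cross_eq_of_weight_eq hq (h x y ((hp x).lt_of_ne' hx) ((hp y).lt_of_ne' hy)))

/-- **STRICT Bhattacharyya ceiling** for every flow with two distinct positive weights:
`acc(p, q) < BC(p, q)²`. [ours] -/
theorem accRate_lt_bhatt_sq {p q : X → ℝ} (hp : ∀ x, 0 ≤ p x) (hq : ∀ x, 0 < q x)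
    (h : ¬ ∀ x y, 0 < p x → 0 < p y → weight p q x = weight p q y) :
    accRate p q < bhatt p q ^ 2 :=
  lt_of_le_of_ne (accRate_le_bhatt_sq hp fun x => (hq x).le)
    fun heq => h ((accRate_eq_bhatt_sq_iff hp hq).1 heq)

variable {Z : Type*} [Fintype Z] {m : ℕ}

/-- **RIGIDITY OF THE UPPER VOLUME LAW**: for normalised nonnegative block targets and positive block
models, `acc(⊗pᵢ, ⊗qᵢ) = ∏ᵢ BC(pᵢ, qᵢ)²` iff EVERY block is hit-or-miss. [ours] -/
theorem accRate_blockProd_eq_prod_bhatt_sq_iff {pb qb : Fin m → Z → ℝ} (hp : ∀ i z, 0 ≤ pb i z)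
    (hq : ∀ i z, 0 < qb i z) (hp1 : ∀ i, ∑ z, pb i z = 1) :
    accRate (blockProd pb) (blockProd qb) = ∏ i, bhatt (pb i) (qb i) ^ 2 ↔
      ∀ i, ∀ z z', 0 < pb i z → 0 < pb i z' → weight (pb i) (qb i) z = weight (pb i) (qb i) z' := by
  have hP : ∀ φ, 0 ≤ blockProd pb φ := fun φ => prod_nonneg fun i _ => hp i _
  have hQ : ∀ φ, 0 < blockProd qb φ := fun φ => prod_pos fun i _ => hq i _
  rw [prod_pow, ← bhatt_blockProd hp fun i z => (hq i z).le, accRate_eq_bhatt_sq_iff hP hQ]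
  constructor
  · intro H i
    by_contra hi
    exact not_hitOrMiss_blockProd hq hp1 hi H
  · intro h
    exact hitOrMiss_blockProd hp h

/-- **Both volume laws tight at once iff all blocks are hit-or-miss**: then
`∏ᵢ accᵢ = acc(⊗) = ∏ᵢ BCᵢ²` (the sandwich of `Scaling/AcceptanceVolumeSandwich` collapses, as for
the two-point hit-or-miss blocks of `accRate_blockProd_hitOrMiss`). [ours] -/
theorem accRate_blockProd_sandwich_collapse {pb qb : Fin m → Z → ℝ} (hp : ∀ i z, 0 ≤ pb i z)
    (hq : ∀ i z, 0 < qb i z) (hp1 : ∀ i, ∑ z, pb i z = 1)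
    (h : ∀ i, ∀ z z', 0 < pb i z → 0 < pb i z' → weight (pb i) (qb i) z = weight (pb i) (qb i) z') :
    ∏ i, accRate (pb i) (qb i) = accRate (blockProd pb) (blockProd qb) ∧
    accRate (blockProd pb) (blockProd qb) = ∏ i, bhatt (pb i) (qb i) ^ 2 :=
  ⟨prod_accRate_eq_accRate_blockProd_of_pairwise hp hq fun i _ _ => Or.inl (h i),
    (accRate_blockProd_eq_prod_bhatt_sq_iff hp hq hp1).2 h⟩

end Bhattacharyya

end Summit.Ventures.LatticeQCDFlow.Theory2
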